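import Summits.PneNP.PneNP.Theorems.KarlinRubinMonotoneBlindFormIter
import Summits.PneNP.PneNP.Theorems.KarlinRubinMonotoneBlindDnfPlanted

/-!
# Route KarlinRubin, crux `MonotoneBlind` (stmt-PneNP-18027): constant depth — the error of the depth reduction

Stage C of the AC⁰ line (seat write-up `MonotoneBlind_AC0_announce.md`).

* `swErr_le_uniform` — along sizes with `m_{i+1}^{v₀} n^E ≤ m_i^{v₀}`, with all fan-in bounds `≤ M̄` and set bounds
  `≤ L̄`: `swErr ≤ d · (M̄^D T(M̄,L̄) / n^E) + L̄ k² / m_d²`;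
* `swForm_planted_le` — **the master inequality per `n`**: for a level-`(d+1)` formula `f` (top gate AND) on the slots
  of `Kₙ` with bounds `(M, L)` and admissible sizes, `Pr_{G(n,1/2,k)}[f] ≤ Pr_{G(n,1/2)}[f] + swErr v₀ k n ms M L`
  (fibre the planted law over the planted set, `f(x ∨ K_A) → f(x) ∨ (f(x ∨ K_A) ∧ ¬ f x)`, and `swIter_count_le`).

All `--supports stmt-PneNP-18027`; no definitions.
-/

set_option linter.dupNamespace false -- `Summit.PneNP.PneNP.…`: summit = sub-problem (D-0017)

namespace Summit.PneNP.PneNP.Theorems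

open Finset Filter
open scoped ENNReal
open Literature.Computability.Complexity
open Literature.Probability.RandomGraphs.PlantedClique

open MonotoneBlind.VertexCover (natCast_div_le_div_of_mul_le)

variable {n : ℕ}

/-! ### A uniform bound for the error -/

/-- Every size along an admissible list is positive. [folklore] -/
theorem pos_of_swSizeOK {v₀ k m : ℕ} {ms : List ℕ} (h : swSizeOK v₀ k m ms) : 0 < m := by
  have := k_le_of_swSizeOK v₀ k ms m h
  omega

/-- **Uniform error bound.** If every consecutive pair of sizes shrinks by `n^E` in the `v₀`-th power, all fan-in
bounds stay `≤ M̄` (`M 2^{r d} ≤ M̄`, `1 ≤ M̄`) and all set bounds `≤ L̄` (`L, r ≤ L̄`), then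
`swErr v₀ k m ms M L ≤ |ms| · (M̄^D T(M̄, L̄) / n^E) + L̄ k² / (last size)²` for any `D ≥ |ms|`. [folklore] -/
theorem swErr_le_uniform (v₀ k E D Mb Lb : ℕ) {N₀ : ℕ} (hN₀ : 0 < N₀) (hMb : 1 ≤ Mb) (hrL : (v₀ - 1).choose 2 ≤ Lb) :
    ∀ (ms : List ℕ) (m M L : ℕ), ms.length ≤ D → M * 2 ^ ((v₀ - 1).choose 2 * ms.length) ≤ Mb → L ≤ Lb →
      swSizeOK v₀ k m ms → swRatioOK v₀ E N₀ m ms →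
      swErr v₀ k m ms M L ≤
        (ms.length : ℝ≥0∞) * (((Mb ^ D * swT v₀ Mb Lb : ℕ) : ℝ≥0∞) / ((N₀ ^ E : ℕ) : ℝ≥0∞)) +
          ((Lb * k ^ 2 : ℕ) : ℝ≥0∞) / ((swLast m ms ^ 2 : ℕ) : ℝ≥0∞) := by
  intro ms
  induction ms with
  | nil =>
    intro m M L _ _ hL hsz _
    have hm := pos_of_swSizeOK hsz
    simp only [swErr, swLast, List.length_nil, Nat.cast_zero, zero_mul, zero_add]
    refine natCast_div_le_div_of_mul_le ?_ (pow_pos hm 2).ne' (pow_pos hm 2).ne'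
    exact Nat.mul_le_mul_right _ (Nat.mul_le_mul_right _ hL)
  | cons m₁ ms ih =>
    intro m M L hD hM hL hsz hrat
    obtain ⟨hv₀m₁, hm₁m, hsz'⟩ := hsz
    obtain ⟨hrat₁, hrat'⟩ := hrat
    have hm := pos_of_swSizeOK (show swSizeOK v₀ k m (m₁ :: ms) from ⟨hv₀m₁, hm₁m, hsz'⟩)
    have hm₁ := pos_of_swSizeOK hsz'
    simp only [List.length_cons] at hD hM
    simp only [swErr, swLast, List.length_cons, Nat.cast_succ]
    -- the fan-in bound at this level and at the next
    have hMle : M ≤ Mb := le_trans (Nat.le_mul_of_pos_right _ (Nat.two_pow_pos _)) hM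
    have hMnext : M * 2 ^ (v₀ - 1).choose 2 * 2 ^ ((v₀ - 1).choose 2 * ms.length) ≤ Mb := by
      have he : (v₀ - 1).choose 2 + (v₀ - 1).choose 2 * ms.length = (v₀ - 1).choose 2 * (ms.length + 1) := by ring
      rw [mul_assoc, ← pow_add, he]; exact hM
    -- the term of this level
    have hterm : ((M ^ (ms.length + 1) * swT v₀ M L * m₁ ^ v₀ : ℕ) : ℝ≥0∞) / ((m ^ v₀ : ℕ) : ℝ≥0∞) ≤
        ((Mb ^ D * swT v₀ Mb Lb : ℕ) : ℝ≥0∞) / ((N₀ ^ E : ℕ) : ℝ≥0∞) := by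
      refine natCast_div_le_div_of_mul_le ?_ (pow_pos hm _).ne' (pow_pos hN₀ _).ne'
      have h1 : M ^ (ms.length + 1) ≤ Mb ^ D :=
        (Nat.pow_le_pow_left hMle _).trans (Nat.pow_le_pow_right hMb hD)
      have h2 : swT v₀ M L ≤ swT v₀ Mb Lb := swT_mono v₀ hMle hL
      calc M ^ (ms.length + 1) * swT v₀ M L * m₁ ^ v₀ * N₀ ^ E
          = M ^ (ms.length + 1) * swT v₀ M L * (m₁ ^ v₀ * N₀ ^ E) := by ring
        _ ≤ Mb ^ D * swT v₀ Mb Lb * m ^ v₀ := Nat.mul_le_mul (Nat.mul_le_mul h1 h2) hrat₁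
    -- the tail, by induction
    have htail := ih m₁ (M * 2 ^ (v₀ - 1).choose 2) ((v₀ - 1).choose 2) (Nat.le_of_succ_le hD) hMnext hrL hsz' hrat'
    calc _ ≤ ((Mb ^ D * swT v₀ Mb Lb : ℕ) : ℝ≥0∞) / ((N₀ ^ E : ℕ) : ℝ≥0∞) +
          ((ms.length : ℝ≥0∞) * (((Mb ^ D * swT v₀ Mb Lb : ℕ) : ℝ≥0∞) / ((N₀ ^ E : ℕ) : ℝ≥0∞)) +
            ((Lb * k ^ 2 : ℕ) : ℝ≥0∞) / ((swLast m₁ ms ^ 2 : ℕ) : ℝ≥0∞)) := add_le_add hterm htail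
      _ = _ := by ring

/-- `(a : ℕ)/(b : ℕ) ≤ n⁻¹` from `a n ≤ b`. [folklore] -/
theorem natCast_div_le_inv {a b n : ℕ} (h : a * n ≤ b) (hb : b ≠ 0) (hn : n ≠ 0) :
    ((a : ℕ) : ℝ≥0∞) / ((b : ℕ) : ℝ≥0∞) ≤ (n : ℝ≥0∞)⁻¹ := by
  have h' := natCast_div_le_div_of_mul_le (a := a) (b := b) (c := 1) (d := n) (by simpa using h) hb hn
  simpa only [Nat.cast_one, one_div] using h'

/-! ### From counts to the planted law -/

open Classical in
/-- **Master inequality per `n` (constant depth).** For a level-`(d+1)` formula `f` with top gate AND on the slots of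
`Kₙ`, with fan-ins `≤ M`, level-`0` sets of `≤ L` slots and admissible sizes `ms` (`|ms| = d`, `swSizeOK v₀ k n ms`):
`Pr_{G(n,1/2,k)}[f] ≤ Pr_{G(n,1/2)}[f] + swErr v₀ k n ms M L`. [folklore] -/
theorem swForm_planted_le {k d v₀ M L : ℕ} (hv₀ : 0 < v₀) (ms : List ℕ) (hms : ms.length = d)
    (f : swForm n (d + 1)) (hf : swBnd M L (d + 1) f) (hsz : swSizeOK v₀ k n ms) :
    (plantedCliqueDist n k).toOuterMeasure {x | swEval (d + 1) false f x} ≤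
      (erdosRenyiHalf n).toOuterMeasure {x | swEval (d + 1) false f x} + swErr v₀ k n ms M L := by
  have hk : k ≤ n := (k_le_of_swSizeOK v₀ k ms n hsz).2
  have hKS : kSubsets n k = powersetCard k (univ : Finset (Fin n)) := by rw [kSubsets, min_eq_left hk]
  have hin : swIn (univ : Finset (Fin n)) (d + 1) f := by
    -- every slot is inside `univ`
    suffices h : ∀ (j : ℕ) (g : swForm n j), swIn (univ : Finset (Fin n)) j g from h _ f
    intro j
    induction j with
    | zero => intro g; rw [swIn_zero]; exact fun _ _ _ _ => mem_univ _
    | succ j ih => intro g; rw [swIn_succ]; exact fun g' _ => ih g'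
  have hcount := swIter_count_le (n := n) v₀ k hv₀ d ms hms univ f M L hin hf (by rwa [card_univ, Fintype.card_fin])
  rw [card_univ, Fintype.card_fin] at hcount
  -- positivity
  have hCnk : 0 < n.choose k := Nat.choose_pos hk
  have hC : ((n.choose k : ℕ) : ℝ≥0∞) ≠ 0 := by exact_mod_cast hCnk.ne'
  have hcardE : (Fintype.card (EdgeVec n) : ℝ≥0∞) =
      (((2 ^ Fintype.card (⊤ : SimpleGraph (Fin n)).edgeSet : ℕ)) : ℝ≥0∞) := by
    rw [Fintype.card_fun, Fintype.card_bool]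
  have h2N : (((2 ^ Fintype.card (⊤ : SimpleGraph (Fin n)).edgeSet : ℕ)) : ℝ≥0∞) ≠ 0 := by
    exact_mod_cast (Nat.two_pow_pos _).ne'
  -- fibre over the planted set and split `f(x ∨ K_A) → f x ∨ (f(x ∨ K_A) ∧ ¬ f x)`
  rw [plantedCliqueDist_toOuterMeasure_eq_sum, hKS, card_powersetCard, card_univ, Fintype.card_fin]
  have hsplit : ∀ A : Finset (Fin n),
      (erdosRenyiHalf n).toOuterMeasure {x | plant A x ∈ {x | swEval (d + 1) false f x}} ≤
        (erdosRenyiHalf n).toOuterMeasure {x | swEval (d + 1) false f x} +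
          (erdosRenyiHalf n).toOuterMeasure {x | swEval (d + 1) false f (plant A x) ∧ ¬ swEval (d + 1) false f x} := by
    intro A
    refine (MeasureTheory.OuterMeasure.mono _ fun x hx => ?_).trans (MeasureTheory.measure_union_le _ _)
    simp only [Set.mem_setOf_eq] at hx
    by_cases hfx : swEval (d + 1) false f x
    · exact Or.inl hfx
    · exact Or.inr ⟨hx, hfx⟩
  -- the second sum as a count
  have hsum : ∑ A ∈ powersetCard k (univ : Finset (Fin n)),
      (erdosRenyiHalf n).toOuterMeasure {x | swEval (d + 1) false f (plant A x) ∧ ¬ swEval (d + 1) false f x} =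
      ((∑ A ∈ powersetCard k (univ : Finset (Fin n)), #(univ.filter fun x : EdgeVec n =>
        swEval (d + 1) false f (plant A x) ∧ ¬ swEval (d + 1) false f x) : ℕ) : ℝ≥0∞) /
        (((2 ^ Fintype.card (⊤ : SimpleGraph (Fin n)).edgeSet : ℕ)) : ℝ≥0∞) := by
    have hcardA : ∀ A : Finset (Fin n),
        #(univ.filter fun x : EdgeVec n =>
            x ∈ {x : EdgeVec n | swEval (d + 1) false f (plant A x) ∧ ¬ swEval (d + 1) false f x}) =
          #(univ.filter fun x : EdgeVec n => swEval (d + 1) false f (plant A x) ∧ ¬ swEval (d + 1) false f x) :=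
      fun A => congrArg Finset.card (by ext x; simp only [mem_filter, Set.mem_setOf_eq])
    rw [Nat.cast_sum]
    simp only [div_eq_mul_inv]
    rw [sum_mul]
    refine sum_congr rfl fun A _ => ?_
    rw [erdosRenyiHalf_toOuterMeasure_eq_card_div, hcardE, hcardA, div_eq_mul_inv]
  calc ((n.choose k : ℕ) : ℝ≥0∞)⁻¹ * ∑ A ∈ powersetCard k (univ : Finset (Fin n)),
        (erdosRenyiHalf n).toOuterMeasure {x | plant A x ∈ {x | swEval (d + 1) false f x}}
      ≤ ((n.choose k : ℕ) : ℝ≥0∞)⁻¹ * ∑ A ∈ powersetCard k (univ : Finset (Fin n)),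
          ((erdosRenyiHalf n).toOuterMeasure {x | swEval (d + 1) false f x} +
            (erdosRenyiHalf n).toOuterMeasure
              {x | swEval (d + 1) false f (plant A x) ∧ ¬ swEval (d + 1) false f x}) := by
        gcongr with A hA
        exact hsplit A
    _ = (erdosRenyiHalf n).toOuterMeasure {x | swEval (d + 1) false f x} +
          ((n.choose k : ℕ) : ℝ≥0∞)⁻¹ * (((∑ A ∈ powersetCard k (univ : Finset (Fin n)),
            #(univ.filter fun x : EdgeVec n => swEval (d + 1) false f (plant A x) ∧ ¬ swEval (d + 1) false f x) : ℕ) :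
              ℝ≥0∞) / (((2 ^ Fintype.card (⊤ : SimpleGraph (Fin n)).edgeSet : ℕ)) : ℝ≥0∞)) := by
        rw [sum_add_distrib, sum_const, card_powersetCard, card_univ, Fintype.card_fin, nsmul_eq_mul, mul_add,
          ← mul_assoc, ENNReal.inv_mul_cancel hC (ENNReal.natCast_ne_top _), one_mul, hsum]
    _ ≤ (erdosRenyiHalf n).toOuterMeasure {x | swEval (d + 1) false f x} +
          ((n.choose k : ℕ) : ℝ≥0∞)⁻¹ * ((((n.choose k : ℕ) : ℝ≥0∞) *
            (((2 ^ Fintype.card (⊤ : SimpleGraph (Fin n)).edgeSet : ℕ)) : ℝ≥0∞) * swErr v₀ k n ms M L) /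
              (((2 ^ Fintype.card (⊤ : SimpleGraph (Fin n)).edgeSet : ℕ)) : ℝ≥0∞)) := by
        gcongr
    _ = _ := by
        congr 1
        rw [mul_right_comm, ENNReal.mul_div_cancel_right h2N (ENNReal.natCast_ne_top _), ← mul_assoc,
          ENNReal.inv_mul_cancel hC (ENNReal.natCast_ne_top _), one_mul]

/-- Registered stub `stub_formErr` of the AC⁰ line, stage C (side result of stmt-PneNP-18027, seat 0). [folklore] -/
theorem stub_formErr : ∀ a b n : ℕ, a * n ≤ b → b ≠ 0 → n ≠ 0 → ((a : ℕ) : ENNReal) / ((b : ℕ) : ENNReal) ≤ ((n : ℕ) : ENNReal)⁻¹ := 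
  fun _ _ _ h hb hn => natCast_div_le_inv h hb hn

end Summit.PneNP.PneNP.Theorems
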